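import Mathlib
import HarnessLib
import Summits.CriticalPhenomena.Ising3DConformalLimit.Theses.PrecisionLaplacian
import Literature.Probability.LatticeModels.GKSInequalities
import Literature.Probability.LatticeModels.IsingModel
import Literature.Probability.LatticeModels.IsingThermodynamics
import Literature.Probability.LatticeModels.ScalingLimit

/-!
# Sketch — crux-ideate round 1, crux `MoebiusLimitOfTwoPointLaw` (stmt-CriticalPhenomena-4801)

First lemmas of the two idea cards (they need not be proved; they must elaborate):

* card `annulus-kelvin-symmetry-scale-axis-gibbs`: `ShellDuality`, `AnnulusNullSphere`
  (parameter-free lattice shadows of the Kelvin symmetry of the two-sided octave specification),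
  `KelvinProfileLaw` (the full one-point law), and the abstract reversal principle
  `reversible_of_unique_symmetric_spec` for finite chains (stated as a Prop).
* card `wormhole-contraction-green-engine`: `ContractionIdentity` (exact, provable now) and
  `ContractedInverseM` (IM is graph-universal, so it covers contracted graphs — stated).
-/

noncomputable section

namespace Summit.CriticalPhenomena.Ising3DConformalLimit.Cruxes.MoebiusLimitOfTwoPointLaw.Sketch

open scoped BigOperators Topology
open Filter Set Literature.Probability.LatticeModels

/-- Euclidean norm of a lattice site of `ℤ³` (as in the crux signature). -/
def siteNorm (z : Site 3) : ℝ := Real.sqrt (∑ i, ((z i : ℝ)) ^ 2)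

/-- The hypothesis of the crux, verbatim: isotropic pure power law of the critical two-point
function. -/
def TwoPointLaw (Δ c : ℝ) : Prop :=
  0 < c ∧ Tendsto (fun x : Site 3 => criticalTwoPoint 3 x * Real.sqrt (∑ i, ((x i : ℝ)) ^ 2) ^ (2 * Δ))
    cofinite (𝓝 c)

/-- Lattice sites of the open annulus `r₁ < δ‖z‖ < r₂` (finite: inside the box of half-side
`⌈r₂/δ⌉₊`). -/
def annulusSites (δ r₁ r₂ : ℝ) : Finset (Site 3) :=
  (box 3 ⌈r₂ / δ⌉₊).filter fun z => r₁ < δ * siteNorm z ∧ δ * siteNorm z < r₂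

/-- Lattice sites of the open ball `δ‖z‖ < r`. -/
def ballSites (δ r : ℝ) : Finset (Site 3) :=
  (box 3 ⌈r / δ⌉₊).filter fun z => δ * siteNorm z < r

/-- The `±` boundary datum of the annulus: `+1` on the inner ball `δ‖z‖ ≤ r₁`, `-1` elsewhere
outside the annulus. -/
def pmConfig (δ r₁ : ℝ) : SpinConfig (Site 3) := fun z => if δ * siteNorm z ≤ r₁ then 1 else -1

/-- **D1 — shell duality (parameter-free).** At criticality, a `+` shell of radius `r/κ` INSIDE
magnetises a spin at radius `r` asymptotically exactly as much as a `+` shell of radius `κ r`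
OUTSIDE: the ratio of the two one-point functions tends to `1` as the mesh `δ → 0⁺`. Inner-shell
problem: `+` frozen on the ball `δ‖z‖ ≤ r/κ` and outside the box `L` (harmless far `+` boundary:
unique critical state), decreasing limit in `L` written as an infimum; outer-shell problem: the
finite ball `δ‖z‖ < κ r` with `+` boundary condition. Conformal prediction
(`ι_r` swaps the two shells and fixes the sphere `‖x‖ = r` pointwise with weight `1`). -/
def ShellDuality : Prop :=
  ∀ Δ c : ℝ, TwoPointLaw Δ c →
    ∀ (κ : ℝ) (x : EuclideanSpace ℝ (Fin 3)), 1 < κ → x ≠ 0 →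
      Tendsto (fun δ : ℝ =>
        (⨅ L : ℕ, isingExpect (zdGraph 3)
            ((box 3 L).filter fun z => ‖x‖ / κ < δ * siteNorm z)
            (criticalBeta 3) 0 .plus (spinAt (latticeApprox δ x))) /
        isingExpect (zdGraph 3) (ballSites δ (κ * ‖x‖)) (criticalBeta 3) 0 .plus
            (spinAt (latticeApprox δ x)))
        (𝓝[>] (0 : ℝ)) (𝓝 1)

/-- **D2 — the null sphere of the `±` annulus (parameter-free).** In the critical lattice annulus
`R₁ < δ‖z‖ < R₂` with `+` frozen inside and `−` frozen outside, the renormalised magnetisation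
vanishes asymptotically exactly on the geometric-mean sphere `‖x‖² = R₁ R₂` (and only there: see
`KelvinProfileLaw`). The renormalisation exponent is the `Δ` of the two-point law. -/
def AnnulusNullSphere : Prop :=
  ∀ Δ c : ℝ, TwoPointLaw Δ c →
    ∀ (R₁ R₂ : ℝ) (x : EuclideanSpace ℝ (Fin 3)), 0 < R₁ → R₁ < R₂ → ‖x‖ ^ 2 = R₁ * R₂ →
      Tendsto (fun δ : ℝ =>
        δ ^ (-Δ) * isingExpect (zdGraph 3) (annulusSites δ R₁ R₂) (criticalBeta 3) 0
          (.fixed (pmConfig δ R₁)) (spinAt (latticeApprox δ x)))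
        (𝓝[>] (0 : ℝ)) (𝓝 0)

/-- **Kelvin law of the `±` annulus profile.** The renormalised one-point function has a limit
`m` on the open annulus which obeys `m(R₁R₂ x/‖x‖²) = -(‖x‖/√(R₁R₂))^{2Δ} m(x)` — inversion in
the geometric-mean sphere swaps the boundary spheres, the global flip swaps the signs. This is
the one-point instance, for `±` data, of the local Kelvin symmetry (LKS) of the two-sided
octave specification. -/
def KelvinProfileLaw : Prop :=
  ∀ Δ c : ℝ, TwoPointLaw Δ c →
    ∀ (R₁ R₂ : ℝ), 0 < R₁ → R₁ < R₂ →
      ∃ m : EuclideanSpace ℝ (Fin 3) → ℝ,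
        (∀ x : EuclideanSpace ℝ (Fin 3), R₁ < ‖x‖ → ‖x‖ < R₂ →
          Tendsto (fun δ : ℝ =>
            δ ^ (-Δ) * isingExpect (zdGraph 3) (annulusSites δ R₁ R₂) (criticalBeta 3) 0
              (.fixed (pmConfig δ R₁)) (spinAt (latticeApprox δ x)))
            (𝓝[>] (0 : ℝ)) (𝓝 (m x))) ∧
        ∀ x : EuclideanSpace ℝ (Fin 3), R₁ < ‖x‖ → ‖x‖ < R₂ →
          m ((R₁ * R₂ / ‖x‖ ^ 2) • x) = -((‖x‖ / Real.sqrt (R₁ * R₂)) ^ (2 * Δ)) * m x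

/-- **Reversal principle (finite shadow).** For a finite state space with an involution `θ` and a
strictly positive two-sided nearest-neighbour specification `γ b a c` ("law of the middle given
left neighbour `a` and right neighbour `c`") which is Kelvin-symmetric, `γ b a c = γ (θ b) (θ c)
(θ a)`, every stationary Markov law `(π, P)` compatible with `γ` is `θ`-reversible:
`π a P a b = π (θ b) P (θ b) (θ a)`. (For finite irreducible chains the two-sided specification
determines the stationary chain uniquely — the 1D Gibbs uniqueness used as the GLOBAL engine of
the card; stated here as a Prop, proof = Perron–Frobenius.) -/
def reversible_of_unique_symmetric_spec : Prop :=
  ∀ (S : Type) [Fintype S] [DecidableEq S] (θ : S ≃ S) (π : S → ℝ) (P : S → S → ℝ),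
    Function.Involutive θ →
    (∀ a, 0 < π a) → (∀ a b, 0 < P a b) → (∀ a, ∑ b, P a b = 1) → (∀ b, ∑ a, π a * P a b = π b) →
    (∀ a b c : S,
      π a * P a b * P b c / (∑ b', π a * P a b' * P b' c) =
        π (θ c) * P (θ c) (θ b) * P (θ b) (θ a) / (∑ b', π (θ c) * P (θ c) b' * P b' (θ a))) →
    ∀ a b : S, π a * P a b = π (θ b) * P (θ b) (θ a)

/-! ### Card `wormhole-contraction-green-engine` -/

/-- Couplings of a pair ferromagnet on `Fin n` plus one extra pair `{x, y}` with coupling `J`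
(index `none`). -/
def addPair {n m : ℕ} (K : Fin m → ℝ) (J : ℝ) : Option (Fin m) → ℝ
  | none => J
  | some i => K i

/-- Interaction sets with the extra pair `{x, y}` at index `none`. -/
def addPairSets {n m : ℕ} (C : Fin m → Finset (Fin n)) (x y : Fin n) : Option (Fin m) → Finset (Fin n)
  | none => {x, y}
  | some i => C i

/-- **Contraction identity (exact; provable now).** Conditioning a finite ferromagnet on
`σ_x = σ_y` is the `J → ∞` limit of an added ferromagnetic pair coupling, i.e. the Ising model on
the CONTRACTED graph, and `⟨σ_uσ_v | σ_x = σ_y⟩ = (⟨σ_uσ_vσ_xσ_y⟩ + ⟨σ_uσ_v⟩)/(1 + ⟨σ_xσ_y⟩)`.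
Hence the four-point function is a two-point function of the contracted graph:
`⟨σ_uσ_vσ_xσ_y⟩ = (1 + ⟨σ_xσ_y⟩)·⟨σ_uσ_v⟩_{x∼y} − ⟨σ_uσ_v⟩`; iterating, every `2n`-point
function is a two-point function of a graph with `n − 1` wormholes. -/
def ContractionIdentity : Prop :=
  ∀ (n m : ℕ) (K : Fin m → ℝ) (C : Fin m → Finset (Fin n)) (x y u v : Fin n),
    Tendsto (fun J : ℝ =>
        gksExpect Finset.univ (addPair (n := n) K J) (addPairSets C x y)
          (fun ω => spinAt u ω * spinAt v ω))
      atTop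
      (𝓝 ((gksExpect Finset.univ K C (fun ω => spinAt u ω * spinAt v ω * (spinAt x ω * spinAt y ω)) +
            gksExpect Finset.univ K C (fun ω => spinAt u ω * spinAt v ω)) /
          (1 + gksExpect Finset.univ K C (fun ω => spinAt x ω * spinAt y ω))))

/-- **IM covers wormholes.** The route's crux `InverseMFerromagnet` quantifies over ALL finite pair
ferromagnets, in particular over contracted tori/boxes; so (IM) ⇒ the conditioned second-moment
matrix `⟨σ_pσ_q | σ_x = σ_y⟩` (the `J → ∞` limit above, restricted to sites `≠ y`) is again an
inverse M-matrix: off-diagonal entries of its inverse are `≤ 0`. Stated as the closure of the IM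
class under `J → ∞` on one pair (limits of inverse-M matrices with positive-definite limit are
inverse-M). -/
def ContractedInverseM : Prop :=
  Summit.CriticalPhenomena.Ising3DConformalLimit.Theses.PrecisionLaplacian.InverseMFerromagnet →
  ∀ (n m : ℕ) (K : Fin m → ℝ) (C : Fin m → Finset (Fin n)), (∀ i, 0 ≤ K i) → (∀ i, (C i).card = 2) →
    ∀ (x y : Fin n), x ≠ y →
    ∀ (M : Matrix {p : Fin n // p ≠ y} {p : Fin n // p ≠ y} ℝ),
      (∀ p q : {p : Fin n // p ≠ y},
        Tendsto (fun J : ℝ =>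
          gksExpect Finset.univ (addPair (n := n) K J) (addPairSets C x y)
            (fun ω => spinAt p.1 ω * spinAt q.1 ω)) atTop (𝓝 (M p q))) →
      M.PosDef → ∀ p q : {p : Fin n // p ≠ y}, p ≠ q → M⁻¹ p q ≤ 0

/-- The composition the line is after (shape only): the two-point law plus the cards' stubs give
the crux. Recorded as the TYPE of the eventual `MoebiusLimitOfTwoPointLaw_of`; no proof here. -/
def TargetShape : Prop :=
  Summit.CriticalPhenomena.Ising3DConformalLimit.Theses.PrecisionLaplacian.MoebiusLimitOfTwoPointLaw

end Summit.CriticalPhenomena.Ising3DConformalLimit.Cruxes.MoebiusLimitOfTwoPointLaw.Sketch
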